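import Literature.NumberTheory.Transcendental.GoncharovCoactionMultiplicative
import Literature.NumberTheory.Transcendental.GoncharovConvAssociative
import HarnessLib

/-!
# The motivic coaction in coordinates is coassociative when `ρ` is a coalgebra map
# (Brown 2012, (2.5), (2.20), Thm 2.4; Deligne–Goncharov 2005, 5.13–5.15; Goncharov 2005,
# Prop 2.2): the field `coaction_coassoc` of `Brown2012.MotivicGaloisData` DERIVED

`BrownMotivicGaloisData.lean` builds Brown's package `MotivicMZV` from the hypothesis bundle
`MotivicGaloisData`; `GoncharovCoactionMultiplicative.lean` derived its field `coaction_mul` from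
`ρ_mul`. This file derives the other structural field, `coaction_coassoc` — "Goncharov's formula
through `ρ` is a coaction of the Hopf algebra `(𝒰', ш, deconcatenation)`" — from the statement
about `ρ` alone which the sources print: the orbit map `g ↦ g(₀1₁)` is a homomorphism from `G_𝒰`
to the torsor of paths with Ihara's/Goncharov's composition ([DG05, 5.13, 5.15]; [Brown2012, §2.1
"the action (2.5) factors through Ihara's"]), i.e. **`ρ`, extended to all endpoints by I0–I3, is a
morphism of coalgebras** from Goncharov's coproduct to the deconcatenation coproduct `Δ` of
`A^MT ≅ 𝒰'` ((2.20)): `Δ(ρ(w)) = Σ_{splittings of w} ρ(∏ Iᵐ(gaps)) ⊗ ρ(kept)` on `𝒪(₀Π₁)`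
(`ρ_coalg`; `decHom_Im_eq_coalgRHS` transports it to `Iᵐ_ρ(x; g; y)` for all endpoints by I0 and
the path composition through `0`, as in Brown's "rewritten in terms of `𝒪(₀Π₁)` only").
Given this, coassociativity of the coaction is Goncharov's coassociativity
([Goncharov2005, Prop 2.2], in the tree as `GoncharovFormalIteratedIntegrals.conv_assoc`) paired
against three families with values in `𝒰' ⊗ 𝒰 ⊗ 𝒪(₀Π₁)`:

* `decHom : 𝒰 →+* 𝒰' ⊗ 𝒰`, the deconcatenation coproduct `Δ f₂^m f_w = Σ_{w = uv} f_u ⊗ f₂^m f_v`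
  ((2.20), `Δ f₂ = 1 ⊗ f₂`), an algebra homomorphism for `ш` by "cuts of shuffles are shuffles of
  cuts" (`WordSeries.sum_shuffleWord_cutSum`); `decHom_apply_zero`: its `f_a ⊗ ·` component is the
  tree's `prefixCoeff a`.
* `coactionG_coassoc`: for `ρ` with the (transported) coalgebra condition,
  `Σ_{sp} L_a(galoisFactor sp) ⊗ kept(sp) = Σ_{sp} [f_a](galoisFactor sp) · coactionG ρ (kept sp)`,
  the field `coaction_coassoc` verbatim.
* `MotivicGaloisData.ofCoalgebraMap`: the bundle from `ρ` (graded shuffle character and coalgebra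
  map), `γ` and the period point — both structural fields being theorems — and
  `motivicMZV_nonempty_of_coalgebraMap`.

Coordinates: `UU = ShuffleMonoidAlgebra ℕ ℕ UAlg` is `𝒰 ⊗ 𝒰` (word part = left factor,
coefficients = right factor), `UUO = ShuffleMonoidAlgebra Unit Bool UU` is `𝒰 ⊗ 𝒰 ⊗ 𝒪(₀Π₁)`.

## References

* F. Brown, *Mixed Tate motives over ℤ*, Ann. of Math. (2) **175** (2012), 949–976, §2.1
  (2.5)–(2.6), §2.4, Theorem 2.4 (2.18), (2.20); arXiv:1102.1312. [Brown2012] [BrownMTM2012]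
* P. Deligne, A. B. Goncharov, *Groupes fondamentaux motiviques de Tate mixte*, Ann. Sci. ÉNS
  **38** (2005), 1–56, §§5.11–5.15. [DeligneGoncharov2005]
* A. B. Goncharov, *Galois symmetries of fundamental groupoids and noncommutative geometry*, Duke
  Math. J. **128** (2005), 209–284, Prop. 2.2, Thm. 2.5. [Goncharov2005]
-/

noncomputable section

open scoped BigOperators

namespace Literature.NumberTheory.Transcendental

/-! ## Two more rules for symbols of a shuffle monoid algebra -/

namespace ShuffleMonoidAlgebra

universe u v w

variable {M : Type u} {α : Type v} {R : Type w} [CommRing R] [AddCommMonoid M]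

omit [AddCommMonoid M] in
/-- `single p` is additive in the coefficient: list sums. [folklore] -/
theorem single_list_sum_map {ι : Type*} (p : M × List α) (L : List ι) (f : ι → R) :
    (single p (L.map f).sum : ShuffleMonoidAlgebra M α R) =
      (L.map fun i => single p (f i)).sum := by
  induction L with
  | nil => simp
  | cons i L ih => rw [List.map_cons, List.sum_cons, single_add, ih, List.map_cons, List.sum_cons]

/-- Product of two symbols with exponent `0`: `(x·u)(y·v) = Σ_{w ∈ u ш v} (xy)·w`.
[cite: Reutenauer1993, §1.4] -/
theorem single_zero_mul_single_zero (u v : List α) (x y : R) :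
    (single (0, u) x * single (0, v) y : ShuffleMonoidAlgebra M α R) =
      ((MZV.shuffleWord u v).map fun w => single (0, w) (x * y)).sum := by
  rw [single_mul_single, mulBasis, List.smul_sum, List.map_map]
  refine congrArg List.sum (List.map_congr_left fun w _ => ?_)
  rw [Function.comp_apply, add_zero, smul_e]

end ShuffleMonoidAlgebra

namespace Brown2012

open MZV ShuffleMonoidAlgebra
open GoncharovFormalIteratedIntegrals (splittings gapProdF conv conv_assoc conv_path
  append_flatMap_eq_of_mem_splittings)
open GoncharovFormalIteratedIntegrals renaming phi → phiK, phi_apply → phiK_apply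
open GoncharovFormalIteratedIntegrals.WordSeries (cutSum cutSum_nil shuffleCutSum
  sum_shuffleWord_cutSum)

/-! ## `𝒰 ⊗ 𝒰` and the deconcatenation coproduct -/

/-- `𝒰 ⊗ 𝒰` in coordinates: the word part (with its exponent of `f₂`, here always `0`) is the
left tensor factor, the coefficient in `𝒰` the right one. [cite: Brown2012, (2.20)–(2.21)] -/
abbrev UU : Type := ShuffleMonoidAlgebra ℕ ℕ UAlg

/-- `𝒰 ⊗ 𝒰` as a `ℚ`-algebra through `ℚ → 𝒰` (an `abbrev`, installed only by `letI` in bodies and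
proofs: the tree's `UU` is a `𝒰`-algebra). [folklore] -/
abbrev ratAlgebraUU : Algebra ℚ UU := Algebra.compHom UU (algebraMap ℚ UAlg)

/-- The deconcatenation table: `f₂^m f_w ↦ Σ_{w = w₁ w₂} f_{w₁} ⊗ f₂^m f_{w₂}` ("`Δ` is the
coproduct … which makes `𝒰'` a Hopf algebra for `ш`", extended by `Δ f₂ = 1 ⊗ f₂`).
[cite: Brown2012, (2.20)–(2.21) and §2.5] -/
def decTable (p : ℕ × List ℕ) : UU :=
  cutSum (fun w₁ w₂ => (single (0, w₁) (e p.1 w₂) : UU)) p.2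

/-- `Δ(1) = 1 ⊗ 1`. [folklore] -/
theorem decTable_nil : decTable (0, []) = 1 := by
  rw [decTable, cutSum_nil]
  rfl

/-- **The deconcatenation table is a shuffle character** ("cuts of shuffles are shuffles of
cuts": the bialgebra axiom of the shuffle Hopf algebra). [cite: Brown2012, (2.20)] -/
theorem decTable_mul (p q : ℕ × List ℕ) :
    decTable p * decTable q = ((shuffleWord p.2 q.2).map fun w => decTable (p.1 + q.1, w)).sum := by
  obtain ⟨m, u⟩ := p
  obtain ⟨n, v⟩ := q
  show cutSum _ u * cutSum _ v = ((shuffleWord u v).map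
    (cutSum fun w₁ w₂ => (single (0, w₁) (e (m + n) w₂) : UU))).sum
  rw [sum_shuffleWord_cutSum, shuffleCutSum, cutSum, cutSum, Finset.sum_mul_sum]
  refine Finset.sum_congr rfl fun i _ => Finset.sum_congr rfl fun j _ => ?_
  rw [single_zero_mul_single_zero, e_mul_e]
  refine congrArg List.sum (List.map_congr_left fun w₁ _ => ?_)
  rw [single_list_sum_map]

/-- **The deconcatenation coproduct `Δ : 𝒰 → 𝒰' ⊗ 𝒰`** as a ring homomorphism (the
`ℚ`-algebra homomorphism extending the shuffle character `decTable`).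
[cite: Brown2012, (2.20)–(2.21)] -/
def decHom : UAlg →+* UU :=
  letI := ratAlgebraUU
  (lift decTable decTable_nil decTable_mul).toRingHom

/-- `Δ` on a symbol. [cite: Brown2012, (2.20)] -/
theorem decHom_single (p : ℕ × List ℕ) (r : ℚ) :
    decHom (single p r) = ∑ k ∈ Finset.range (p.2.length + 1),
      single (0, p.2.take k) (single (p.1, p.2.drop k) r) := by
  letI := ratAlgebraUU
  show lift decTable decTable_nil decTable_mul (single p r) = _
  rw [lift_single]
  show (algebraMap ℚ UAlg r) • decTable p = _
  rw [decTable, cutSum, Finset.smul_sum]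
  refine Finset.sum_congr rfl fun k _ => ?_
  rw [smul_single, ← Algebra.smul_def, smul_e]

/-- **The `f_a ⊗ ·` component of `Δ x` is `L_a x`** (the tree's `prefixCoeff a`).
[cite: Brown2012, (2.20)] -/
theorem decHom_apply_zero (x : UAlg) (a : List ℕ) : decHom x (0, a) = prefixCoeff a x := by
  classical
  induction x using ShuffleMonoidAlgebra.induction_linear with
  | h0 => rw [map_zero, map_zero, ShuffleMonoidAlgebra.zero_apply]
  | hadd x y hx hy => rw [map_add, map_add, ShuffleMonoidAlgebra.add_apply, hx, hy]
  | hsingle p r =>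
    obtain ⟨m, w⟩ := p
    refine DFunLike.ext _ _ fun q => ?_
    rw [prefixCoeff_apply, decHom_single, finset_sum_apply, finset_sum_apply, single_apply]
    have hterm : ∀ k, ((single (0, w.take k) (single (m, w.drop k) r) : UU) (0, a)) q =
        if w.take k = a ∧ (m, w.drop k) = q then r else 0 := fun k => by
      rw [single_apply]
      by_cases h : w.take k = a
      · rw [if_pos (by rw [h]), single_apply]
        simp [h]
      · rw [if_neg (by simpa using h), ShuffleMonoidAlgebra.zero_apply]
        simp [h]
    simp_rw [hterm]
    rw [Finset.sum_eq_single a.length]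
    · congr 1
      apply propext
      constructor
      · rintro ⟨h1, h2⟩
        subst h2
        refine Prod.ext rfl ?_
        show w = a ++ List.drop a.length w
        conv_lhs => rw [← List.take_append_drop a.length w, h1]
      · intro h
        obtain ⟨rfl, rfl⟩ := Prod.mk.inj h
        exact ⟨List.take_left' rfl, by rw [List.drop_left' rfl]⟩
    · intro k hk hka
      rw [if_neg]
      rintro ⟨h1, -⟩
      have := congrArg List.length h1
      rw [List.length_take, Nat.min_eq_left (Nat.lt_succ_iff.1 (Finset.mem_range.1 hk))] at this
      exact hka this
    · intro ha
      rw [if_neg]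
      rintro ⟨h1, -⟩
      have := congrArg List.length h1
      rw [List.length_take] at this
      simp only [Finset.mem_range, not_lt] at ha
      omega

/-! ## `𝒰 → 𝒰 ⊗ 1` -/

/-- The left coprojection `x ↦ x ⊗ 1` of `𝒰` into `𝒰 ⊗ 𝒰` (coefficients `ℚ → 𝒰`), a ring
homomorphism. [folklore] -/
def leftEmb : UAlg →+* UU :=
  letI := ratAlgebraUU
  (lift (fun p => (e p.1 p.2 : UU)) rfl fun p q => e_mul_e p.1 q.1 p.2 q.2).toRingHom

/-- `leftEmb` on a symbol. [folklore] -/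
theorem leftEmb_single (p : ℕ × List ℕ) (r : ℚ) :
    leftEmb (single p r) = single p (algebraMap ℚ UAlg r) := by
  letI := ratAlgebraUU
  show lift (fun p => (e p.1 p.2 : UU)) rfl (fun p q => e_mul_e p.1 q.1 p.2 q.2) (single p r) = _
  rw [lift_single]
  show (algebraMap ℚ UAlg r) • (e p.1 p.2 : UU) = _
  rw [smul_e]

/-- Coefficients of `x ⊗ 1`. [folklore] -/
theorem leftEmb_apply (x : UAlg) (q : ℕ × List ℕ) : leftEmb x q = algebraMap ℚ UAlg (x q) := by
  classical
  induction x using ShuffleMonoidAlgebra.induction_linear with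
  | h0 => simp
  | hadd x y hx hy => rw [map_add, ShuffleMonoidAlgebra.add_apply, hx, hy,
      ShuffleMonoidAlgebra.add_apply, map_add]
  | hsingle p r =>
    rw [leftEmb_single, single_apply, single_apply]
    split_ifs <;> simp

/-- `(x ⊗ y)` has `f_a ⊗ ·` component `x(f_a) · y`. [folklore] -/
theorem leftEmb_mul_algebraMap_apply (x y : UAlg) (q : ℕ × List ℕ) :
    (leftEmb x * algebraMap UAlg UU y) q = x q • y := by
  rw [← Algebra.commutes, ← Algebra.smul_def, ShuffleMonoidAlgebra.smul_apply, leftEmb_apply,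
    mul_comm, ← Algebra.smul_def]

/-! ## The coalgebra condition on `ρ`, and its transport to all endpoints -/

section Coalgebra

variable (ρ : List Bool → UAlg)

/-- The right-hand side of the coalgebra condition: `(ρ ⊗ ρ)(Δ_G Iᵐ(x; g; y)) =
Σ_{splittings of g} ρ(∏ Iᵐ(gaps)) ⊗ ρ(Iᵐ(x; kept; y))`, Goncharov's coproduct of `Iᵐ(x;g;y)`
read through `ρ` in `𝒰 ⊗ 𝒰`. [cite: Brown2012, (2.5)–(2.6), Theorem 2.4 (2.18)] -/
def coalgRHS (x : Bool) (g : List Bool) (y : Bool) : UU :=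
  ((splittings g).map fun sp => leftEmb (galoisFactor ρ x sp.1 sp.2 y) *
    algebraMap UAlg UU (Im ρ x (kept sp.2) y)).sum

/-- `gapProdF` of a family `K = φ ∘ Iᵐ_ρ`, `φ` multiplicative, is `φ ∘ galoisFactor ρ` (same
recursion). [cite: Brown2012, Theorem 2.4 (2.18)] -/
theorem gapProdF_of_eq {B : Type*} [CommRing B] (φ : UAlg →+* B)
    {K : Bool → List Bool → Bool → B} (hK : ∀ x g y, K x g y = φ (Im ρ x g y)) :
    ∀ (x : Bool) (g : List Bool) (ps : List (Bool × List Bool)) (y : Bool),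
      gapProdF K x g ps y = φ (galoisFactor ρ x g ps y)
  | x, g, [], y => hK x g y
  | x, g, p :: ps, y => by
    rw [gapProdF, galoisFactor, map_mul, gapProdF_of_eq φ hK, hK]

/-- (iii) for a family `φ ∘ Iᵐ_ρ` (`ρ` a shuffle character, `φ` a ring homomorphism), as the
identity `Φ_{a,y} Φ_{y,b} = Φ_{a,b}` of generating series. [cite: Brown2012, §2.4] -/
theorem phiK_mul_of_eq {B : Type*} [CommRing B] (φ : UAlg →+* B)
    {K : Bool → List Bool → Bool → B} (hK : ∀ x g y, K x g y = φ (Im ρ x g y))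
    (hρ1 : ρ [] = 1) (hρmul : ∀ u v : List Bool, ρ u * ρ v = ((shuffleWord u v).map ρ).sum)
    (a y b : Bool) : phiK K a y * phiK K y b = phiK K a b := by
  refine GoncharovFormalIteratedIntegrals.WordSeries.ext fun w => ?_
  rw [GoncharovFormalIteratedIntegrals.WordSeries.mul_apply]
  simp only [phiK_apply, hK, ← map_mul]
  rw [← map_sum, Im_path hρ1 hρmul]

/-- `coalgRHS` is Goncharov's composite `conv (1 ⊗ ρ) (ρ ⊗ 1)` of the two coprojections.
[cite: Brown2012, Theorem 2.4 (2.18); Goncharov2005, §2.1] -/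
theorem coalgRHS_eq_conv (x : Bool) (g : List Bool) (y : Bool) :
    coalgRHS ρ x g y = conv (fun x c y => algebraMap UAlg UU (Im ρ x c y))
      (fun x g y => leftEmb (Im ρ x g y)) x g y := by
  rw [coalgRHS, conv]
  refine congrArg List.sum (List.map_congr_left fun sp _ => ?_)
  rw [gapProdF_of_eq ρ leftEmb (fun _ _ _ => rfl), kept]
  exact mul_comm _ _

/-- `coalgRHS` satisfies the path composition (iii) (`conv_path`).
[cite: Goncharov2005, Prop 2.2] -/
theorem coalgRHS_path (hρ1 : ρ [] = 1)
    (hρmul : ∀ u v : List Bool, ρ u * ρ v = ((shuffleWord u v).map ρ).sum)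
    (x y z : Bool) (g : List Bool) :
    coalgRHS ρ x g z = ∑ k ∈ Finset.range (g.length + 1),
      coalgRHS ρ x (g.take k) y * coalgRHS ρ y (g.drop k) z := by
  simp only [coalgRHS_eq_conv]
  exact conv_path (phiK_mul_of_eq ρ (algebraMap UAlg UU) (fun _ _ _ => rfl) hρ1 hρmul)
    (phiK_mul_of_eq ρ leftEmb (fun _ _ _ => rfl) hρ1 hρmul) x y z g

/-- `coalgRHS(x; ∅; y) = 1`. [folklore] -/
theorem coalgRHS_nil (hρ1 : ρ [] = 1) (x y : Bool) : coalgRHS ρ x [] y = 1 := by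
  rw [coalgRHS]
  simp [splittings, galoisFactor, kept, hρ1]

/-- `coalgRHS(x; g; x) = 0` for `g ≠ ∅` (I0 on one of the two factors of each term). [folklore] -/
theorem coalgRHS_self (x : Bool) {g : List Bool} (hg : g ≠ []) : coalgRHS ρ x g x = 0 := by
  rw [coalgRHS]
  refine List.sum_eq_zero fun t ht => ?_
  obtain ⟨sp, hsp, rfl⟩ := List.mem_map.1 ht
  by_cases h : sp.2 = []
  · have hg₀ : sp.1 = g := by
      have := append_flatMap_eq_of_mem_splittings g hsp
      rwa [h, List.flatMap_nil, List.append_nil] at this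
    obtain ⟨g₀, ps⟩ := sp
    simp only at h hg₀
    subst h hg₀
    rw [galoisFactor, Im_self ρ x hg, map_zero, zero_mul]
  · rw [Im_self ρ x (by rwa [kept, ne_eq, List.map_eq_nil_iff]), map_zero, mul_zero]

/-- `Δ ∘ Iᵐ_ρ` satisfies the path composition (iii) (`Δ` is a ring homomorphism).
[cite: Brown2012, §2.4] -/
theorem decHom_Im_path (hρ1 : ρ [] = 1)
    (hρmul : ∀ u v : List Bool, ρ u * ρ v = ((shuffleWord u v).map ρ).sum)
    (x y z : Bool) (g : List Bool) :
    decHom (Im ρ x g z) = ∑ k ∈ Finset.range (g.length + 1),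
      decHom (Im ρ x (g.take k) y) * decHom (Im ρ y (g.drop k) z) := by
  rw [← Im_path hρ1 hρmul x y z g, map_sum]
  exact Finset.sum_congr rfl fun k _ => map_mul _ _ _

/-- **Transport of the coalgebra condition to all endpoints.** If `ρ` is a shuffle character and
`Δ(ρ(w)) = (ρ ⊗ ρ)(Δ_G w)` on `𝒪(₀Π₁)` (endpoints `0, 1`), then
`Δ(ρ(Iᵐ(x;g;y))) = (ρ ⊗ ρ)(Δ_G Iᵐ(x;g;y))` for all endpoints: for `x = y` both sides vanish (I0),
and for `(x,y) = (1,0)` both sides satisfy the path composition (iii) through the point `0`,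
`Iᵐ(1;g;1) = Σ_{g = uv} Iᵐ(1;u;0) Iᵐ(0;v;1)`, which determines `Iᵐ(1;·;0)` recursively from
`Iᵐ(0;·;1)` — Brown's "the formula … can easily be rewritten in terms of `𝒪(₀Π₁)` only".
[cite: Brown2012, §2.4 I0–I3; Goncharov2005, Prop 2.2] -/
theorem decHom_Im_eq_coalgRHS (hρ1 : ρ [] = 1)
    (hρmul : ∀ u v : List Bool, ρ u * ρ v = ((shuffleWord u v).map ρ).sum)
    (h01 : ∀ g : List Bool, decHom (ρ g) = coalgRHS ρ false g true) :
    ∀ (x : Bool) (g : List Bool) (y : Bool), decHom (Im ρ x g y) = coalgRHS ρ x g y := by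
  have hnil : ∀ x y, decHom (Im ρ x [] y) = coalgRHS ρ x [] y := fun x y => by
    rw [Im_nil, hρ1, map_one, coalgRHS_nil ρ hρ1]
  have hself : ∀ (x : Bool) (g : List Bool), decHom (Im ρ x g x) = coalgRHS ρ x g x := by
    intro x g
    by_cases hg : g = []
    · subst hg
      exact hnil x x
    · rw [Im_self ρ x hg, map_zero, coalgRHS_self ρ x hg]
  have hft : ∀ g : List Bool, decHom (Im ρ false g true) = coalgRHS ρ false g true := fun g => by
    rw [Im_false_true]
    exact h01 g
  have htf : ∀ (n : ℕ) (g : List Bool), g.length ≤ n →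
      decHom (Im ρ true g false) = coalgRHS ρ true g false := by
    intro n
    induction n with
    | zero =>
      intro g hg
      obtain rfl := List.eq_nil_of_length_eq_zero (Nat.le_zero.1 hg)
      exact hnil true false
    | succ n ih =>
      intro g hg
      by_cases hgn : g = []
      · subst hgn
        exact hnil true false
      have key : ∀ k ∈ Finset.range g.length,
          decHom (Im ρ true (g.take k) false) * decHom (Im ρ false (g.drop k) true) =
            coalgRHS ρ true (g.take k) false * coalgRHS ρ false (g.drop k) true := fun k hk => by
        have hk' := Finset.mem_range.1 hk
        rw [ih (g.take k) (by rw [List.length_take]; omega), hft]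
      have e1 : decHom (Im ρ true g true) = (∑ k ∈ Finset.range g.length,
          coalgRHS ρ true (g.take k) false * coalgRHS ρ false (g.drop k) true) +
            decHom (Im ρ true g false) := by
        rw [decHom_Im_path ρ hρ1 hρmul true false true g, Finset.sum_range_succ, List.take_length,
          List.drop_length, Im_nil, hρ1, map_one, mul_one, Finset.sum_congr rfl key]
      have e2 : coalgRHS ρ true g true = (∑ k ∈ Finset.range g.length,
          coalgRHS ρ true (g.take k) false * coalgRHS ρ false (g.drop k) true) +
            coalgRHS ρ true g false := by
        rw [coalgRHS_path ρ hρ1 hρmul true false true g, Finset.sum_range_succ, List.take_length,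
          List.drop_length, coalgRHS_nil ρ hρ1, mul_one]
      rw [hself] at e1
      exact add_left_cancel (e1.symm.trans e2)
  intro x g y
  cases x <;> cases y
  exacts [hself false g, hft g, htf g.length g le_rfl, hself true g]

end Coalgebra

/-! ## `𝒰 ⊗ 𝒰 ⊗ 𝒪(₀Π₁)` and the three families -/

/-- `𝒰 ⊗ 𝒰 ⊗ 𝒪(₀Π₁)`: binary words with coefficients in `𝒰 ⊗ 𝒰`. [cite: Brown2012, (2.5)] -/
abbrev UUO : Type := ShuffleMonoidAlgebra Unit Bool UU

/-- `𝒰 ⊗ 𝒰 ⊗ 𝒪(₀Π₁)` as a `ℚ`-algebra (an `abbrev`, installed only by `letI`). [folklore] -/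
abbrev ratAlgebraUUO : Algebra ℚ UUO :=
  letI := ratAlgebraUU
  Algebra.compHom UUO (algebraMap ℚ UU)

section Families

variable (ρ : List Bool → UAlg)

/-- The word `c` as `1 ⊗ 1 ⊗ c`. [folklore] -/
def wordO (c : List Bool) : UUO := e () c

/-- `1 ⊗ 1 ⊗ ∅ = 1`. [folklore] -/
theorem wordO_nil : wordO [] = 1 := rfl

/-- `c ↦ 1 ⊗ 1 ⊗ c` is a shuffle character. [cite: Brown2012, (2.1)] -/
theorem wordO_mul (u v : List Bool) : wordO u * wordO v = ((shuffleWord u v).map wordO).sum := by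
  rw [wordO, wordO, e_mul_e]
  rfl

/-- Family 1 (outer kept word): `Iᵐ(x;c;y) ↦ 1 ⊗ 1 ⊗ Iᵐ(x;c;y)` reduced by I0, I1, I3.
[cite: Brown2012, §2.4, (2.18)] -/
def keptFamilyO (x : Bool) (c : List Bool) (y : Bool) : UUO :=
  letI := ratAlgebraUUO
  Im wordO x c y

/-- Family 2 (middle factor): `Iᵐ(x;c;y) ↦ 1 ⊗ ρ(Iᵐ(x;c;y)) ⊗ 1`. [cite: Brown2012, (2.5)–(2.6)] -/
def midFamily (x : Bool) (c : List Bool) (y : Bool) : UUO :=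
  algebraMap UU UUO (algebraMap UAlg UU (Im ρ x c y))

/-- Family 3 (left factor): `Iᵐ(x;g;y) ↦ ρ(Iᵐ(x;g;y)) ⊗ 1 ⊗ 1`. [cite: Brown2012, (2.5)–(2.6)] -/
def leftFamily (x : Bool) (g : List Bool) (y : Bool) : UUO :=
  algebraMap UU UUO (leftEmb (Im ρ x g y))

/-- The composite family `Iᵐ(x;g;y) ↦ Δ(ρ(Iᵐ(x;g;y))) ⊗ 1`. [cite: Brown2012, (2.5), (2.20)] -/
def decFamily (x : Bool) (g : List Bool) (y : Bool) : UUO :=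
  algebraMap UU UUO (decHom (Im ρ x g y))

/-- `conv keptFamilyO (φ ∘ Iᵐ_ρ ⊗ 1) (0; w; 1) = Σ_{sp} (1 ⊗ 1 ⊗ kept sp) · φ(galoisFactor sp)`
for a ring homomorphism `φ : 𝒰 → 𝒰 ⊗ 𝒰`: Theorem 2.4 (2.18) with the Galois factor read
through `φ`. [cite: Brown2012, Theorem 2.4 (2.18)] -/
theorem conv_keptFamilyO (φ : UAlg →+* UU) {K : Bool → List Bool → Bool → UUO}
    (hK : ∀ x g y, K x g y = algebraMap UU UUO (φ (Im ρ x g y))) (w : List Bool) :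
    conv keptFamilyO K false w true =
      ((splittings w).map fun sp =>
        (single ((), kept sp.2) (φ (galoisFactor ρ false sp.1 sp.2 true)) : UUO)).sum := by
  letI := ratAlgebraUUO
  rw [conv]
  refine congrArg List.sum (List.map_congr_left fun sp _ => ?_)
  rw [gapProdF_of_eq ρ ((algebraMap UU UUO).comp φ) (K := K) hK, RingHom.comp_apply,
    keptFamilyO, Im_false_true, ← Algebra.commutes, ← Algebra.smul_def, wordO, smul_e, kept]

/-- **`ρ` a coalgebra map ⟹ `Δ ∘ galois = conv midFamily leftFamily`**: with `hcoalg`, the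
family `Iᵐ(x;g;y) ↦ Δ(ρ(Iᵐ(x;g;y)))` is Goncharov's composite of the families
`1 ⊗ ρ ⊗ 1` and `ρ ⊗ 1 ⊗ 1`. [cite: Brown2012, (2.5), (2.20); Goncharov2005, §2.1] -/
theorem decFamily_eq_conv
    (hcoalg : ∀ (x : Bool) (g : List Bool) (y : Bool), decHom (Im ρ x g y) = coalgRHS ρ x g y) :
    decFamily ρ = conv (midFamily ρ) (leftFamily ρ) := by
  funext x g y
  rw [decFamily, hcoalg, coalgRHS, conv, map_list_sum, List.map_map]
  refine congrArg List.sum (List.map_congr_left fun sp _ => ?_)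
  rw [Function.comp_apply, map_mul,
    gapProdF_of_eq ρ ((algebraMap UU UUO).comp leftEmb) (K := leftFamily ρ) (fun _ _ _ => rfl),
    RingHom.comp_apply, midFamily, kept]
  exact mul_comm _ _

/-- (ii) for `keptFamilyO`. [cite: Brown2012, §2.4] -/
theorem keptFamilyO_mul (a b : Bool) (u v : List Bool) :
    keptFamilyO a u b * keptFamilyO a v b =
      ((shuffleWord u v).map fun s => keptFamilyO a s b).sum := by
  letI := ratAlgebraUUO
  exact Im_mul wordO_nil wordO_mul a b u v

/-- The right-hand side of coassociativity as a composite: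
`conv (conv keptFamilyO midFamily) leftFamily (0;w;1) = Σ_{sp} Σ_{sp' of kept sp}
(galoisFactor sp ⊗ galoisFactor sp' ⊗ kept sp')`, i.e. `(id ⊗ coactionG) (coactionG w)` with the
tensor factors in the order `left ⊗ middle ⊗ word`. [cite: Brown2012, Theorem 2.4 (2.18)] -/
theorem conv_conv_keptFamilyO (w : List Bool) :
    conv (conv keptFamilyO (midFamily ρ)) (leftFamily ρ) false w true =
      ((splittings w).map fun sp => ((splittings (kept sp.2)).map fun sp' =>
        (single ((), kept sp'.2) (leftEmb (galoisFactor ρ false sp.1 sp.2 true) *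
          algebraMap UAlg UU (galoisFactor ρ false sp'.1 sp'.2 true)) : UUO)).sum).sum := by
  rw [conv]
  refine congrArg List.sum (List.map_congr_left fun sp _ => ?_)
  rw [gapProdF_of_eq ρ ((algebraMap UU UUO).comp leftEmb) (K := leftFamily ρ) (fun _ _ _ => rfl),
    RingHom.comp_apply, ← kept,
    conv_keptFamilyO ρ (algebraMap UAlg UU) (K := midFamily ρ) (fun _ _ _ => rfl),
    ← List.sum_map_mul_right]
  refine congrArg List.sum (List.map_congr_left fun sp' _ => ?_)
  rw [← Algebra.commutes, ← Algebra.smul_def, smul_single]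

end Families

/-! ## Extracting the `f_a ⊗ · ⊗ ·` component -/

/-- The `f_a ⊗ · ⊗ ·` component `𝒰 ⊗ 𝒰 ⊗ 𝒪(₀Π₁) → 𝒰 ⊗ 𝒪(₀Π₁)` (coefficientwise evaluation of
the `𝒰 ⊗ 𝒰`-coefficients at `f_a ⊗ ·`). [folklore] -/
def coeffAt (a : List ℕ) : UUO →+ UShuffle where
  toFun Z := ⟨Z.toFinsupp.mapRange (fun c : UU => c (0, a)) rfl⟩
  map_zero' := toFinsupp_injective (by simp)
  map_add' Z W := toFinsupp_injective (by
    simp only [toFinsupp_add]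
    exact Finsupp.mapRange_add (fun _ _ => rfl) _ _)

/-- `coeffAt a` on a symbol. [folklore] -/
theorem coeffAt_single (a : List ℕ) (c : Unit × List Bool) (Z : UU) :
    coeffAt a (single c Z) = single c (Z (0, a)) :=
  toFinsupp_injective (by simp [coeffAt, Finsupp.mapRange_single])

/-! ## Coassociativity -/

/-- **The coaction in coordinates is coassociative when `ρ` is a coalgebra map.** If
`Δ(ρ(Iᵐ(x;g;y))) = Σ_{sp} ρ(galoisFactor sp) ⊗ ρ(Iᵐ(x; kept sp; y))` for all endpoints (the orbit
map `G_𝒰 → Π` is a homomorphism for Goncharov's/Ihara's composition, [DG05, 5.13, 5.15];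
[Brown2012, §2.1]), then Goncharov's formula through `ρ` is a coaction of `(𝒰', deconcatenation)`:
its `f_a ⊗ · ⊗ ·` component reads
`Σ_{sp} L_a(galoisFactor sp) ⊗ kept(sp) = Σ_{sp} [f_a](galoisFactor sp) · coactionG ρ (kept sp)` —
the field `coaction_coassoc` of `MotivicGaloisData`. The proof pairs Goncharov's coassociativity
`conv_assoc` ([Goncharov2005, Prop 2.2]) against the families `keptFamilyO`, `midFamily ρ`,
`leftFamily ρ`. [cite: Brown2012, (2.5), (2.20), Theorem 2.4; Goncharov2005, Prop 2.2] -/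
theorem coactionG_coassoc {ρ : List Bool → UAlg}
    (hcoalg : ∀ (x : Bool) (g : List Bool) (y : Bool), decHom (Im ρ x g y) = coalgRHS ρ x g y)
    (w : List Bool) (a : List ℕ) :
    ((splittings w).map fun sp =>
      (ShuffleMonoidAlgebra.single ((), kept sp.2)
        (prefixCoeff a (galoisFactor ρ false sp.1 sp.2 true)) : UShuffle)).sum =
    ((splittings w).map fun sp =>
      algebraMap ℚ UAlg (galoisFactor ρ false sp.1 sp.2 true (0, a)) •
        coactionG ρ (kept sp.2)).sum := by
  -- the identity `(Δ ⊗ id) ∘ coactionG = (id ⊗ coactionG) ∘ coactionG` in `𝒰 ⊗ 𝒰 ⊗ 𝒪(₀Π₁)`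
  have total : ((splittings w).map fun sp => (single ((), kept sp.2)
      (decHom (galoisFactor ρ false sp.1 sp.2 true)) : UUO)).sum =
      ((splittings w).map fun sp => ((splittings (kept sp.2)).map fun sp' =>
        (single ((), kept sp'.2) (leftEmb (galoisFactor ρ false sp.1 sp.2 true) *
          algebraMap UAlg UU (galoisFactor ρ false sp'.1 sp'.2 true)) : UUO)).sum).sum := by
    rw [← conv_keptFamilyO ρ decHom (K := decFamily ρ) (fun _ _ _ => rfl),
      ← conv_conv_keptFamilyO, decFamily_eq_conv ρ hcoalg, conv_assoc]
  have h := congrArg (coeffAt a) total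
  rw [map_list_sum, map_list_sum, List.map_map, List.map_map] at h
  convert h using 1
  · refine congrArg List.sum (List.map_congr_left fun sp _ => ?_)
    rw [Function.comp_apply, coeffAt_single, decHom_apply_zero]
  · refine congrArg List.sum (List.map_congr_left fun sp _ => ?_)
    rw [Function.comp_apply, map_list_sum, List.map_map, coactionG, List.smul_sum, List.map_map]
    refine congrArg List.sum (List.map_congr_left fun sp' _ => ?_)
    rw [Function.comp_apply, Function.comp_apply, coeffAt_single, leftEmb_mul_algebraMap_apply,
      smul_single, ← Algebra.smul_def]

/-! ## The bundle from a coalgebra map `ρ` -/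

namespace MotivicGaloisData

/-- **`MotivicGaloisData` from a graded shuffle character `ρ : 𝒪(₀Π₁) → 𝒰'` which is a
coalgebra map for Goncharov's coproduct and deconcatenation (`Δ ∘ ρ = (ρ ⊗ ρ) ∘ Δ_G` on
`𝒪(₀Π₁)`), an even point `γ` and the period point `(g, t₀)`** — multiplicativity AND
coassociativity of the coaction being theorems (`coactionG_mul`, `coactionG_coassoc`).
[cite: Brown2012, §2.1 (2.5)–(2.6), (2.20), Theorem 2.4; DeligneGoncharov2005, 5.13–5.15;
Goncharov2005, Prop 2.2] -/
def ofCoalgebraMap (ρ : List Bool → UAlg) (ρ_nil : ρ [] = 1)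
    (ρ_mul : ∀ u v : List Bool, ρ u * ρ v = ((shuffleWord u v).map ρ).sum)
    (ρ_mem : ∀ w : List Bool, ρ w ∈ uPrime w.length)
    (ρ_coalg : ∀ w : List Bool, decHom (ρ w) =
      ((splittings w).map fun sp => leftEmb (galoisFactor ρ false sp.1 sp.2 true) *
        algebraMap UAlg UU (ρ (kept sp.2))).sum)
    (γ : List Bool → ℚ) (γ_nil : γ [] = 1)
    (γ_mul : ∀ u v : List Bool, γ u * γ v = ((shuffleWord u v).map γ).sum)
    (γ_odd : ∀ w : List Bool, Odd w.length → γ w = 0)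
    (g : List ℕ → ℝ) (g_nil : g [] = 1)
    (g_mul : ∀ a b : List ℕ, g a * g b = ((shuffleWord a b).map g).sum) (t₀ : ℝ)
    (period : ∀ s : List ℕ, IsAdmissible s →
      perLin g t₀ (Ψ ρ γ (rho s.reverse)) = multipleZeta s) :
    MotivicGaloisData :=
  mk' ρ ρ_nil ρ_mul ρ_mem
    (coactionG_coassoc (decHom_Im_eq_coalgRHS ρ ρ_nil ρ_mul fun w => by
      rw [ρ_coalg w, coalgRHS]
      simp only [Im_false_true]))
    γ γ_nil γ_mul γ_odd g g_nil g_mul t₀ period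

/-- The constructor does not change `ρ`. [folklore] -/
@[simp] theorem ofCoalgebraMap_ρ (ρ : List Bool → UAlg) (ρ_nil ρ_mul ρ_mem ρ_coalg)
    (γ : List Bool → ℚ) (γ_nil γ_mul γ_odd) (g : List ℕ → ℝ) (g_nil g_mul) (t₀ : ℝ) (period) :
    (ofCoalgebraMap ρ ρ_nil ρ_mul ρ_mem ρ_coalg γ γ_nil γ_mul γ_odd g g_nil g_mul t₀
      period).ρ = ρ :=
  rfl

end MotivicGaloisData

/-- **Brown's package from a coalgebra map**: a graded shuffle character `ρ : 𝒪(₀Π₁) → 𝒰'`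
intertwining Goncharov's coproduct with deconcatenation, an even rational point `γ` and a real
period point `(g, t₀)` matching the multiple zeta values on convergent words yield an inhabitant
of `MotivicMZV`. [cite: Brown2012, §§2.1–2.5, §3.1; DeligneGoncharov2005, 5.13–5.15;
Goncharov2005, Prop 2.2] -/
theorem motivicMZV_nonempty_of_coalgebraMap (ρ : List Bool → UAlg) (ρ_nil : ρ [] = 1)
    (ρ_mul : ∀ u v : List Bool, ρ u * ρ v = ((shuffleWord u v).map ρ).sum)
    (ρ_mem : ∀ w : List Bool, ρ w ∈ uPrime w.length)
    (ρ_coalg : ∀ w : List Bool, decHom (ρ w) =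
      ((GoncharovFormalIteratedIntegrals.splittings w).map fun sp =>
        leftEmb (galoisFactor ρ false sp.1 sp.2 true) * algebraMap UAlg UU (ρ (kept sp.2))).sum)
    (γ : List Bool → ℚ) (γ_nil : γ [] = 1)
    (γ_mul : ∀ u v : List Bool, γ u * γ v = ((shuffleWord u v).map γ).sum)
    (γ_odd : ∀ w : List Bool, Odd w.length → γ w = 0)
    (g : List ℕ → ℝ) (g_nil : g [] = 1)
    (g_mul : ∀ a b : List ℕ, g a * g b = ((shuffleWord a b).map g).sum) (t₀ : ℝ)
    (period : ∀ s : List ℕ, IsAdmissible s →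
      perLin g t₀ (Ψ ρ γ (rho s.reverse)) = multipleZeta s) :
    motivicMZV_nonempty :=
  ⟨(MotivicGaloisData.ofCoalgebraMap ρ ρ_nil ρ_mul ρ_mem ρ_coalg γ γ_nil γ_mul γ_odd g g_nil
    g_mul t₀ period).toMotivicMZV⟩

end Brown2012

end Literature.NumberTheory.Transcendental
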